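import Summits.Parity.GeneralizedHardyLittlewood.Theorems.LeeYangFibresRelativeDimOneMoebiusSplitDefs
import HarnessLib

/-!
# Crux `RelativeDimOne` (stmt-Parity-14113), line `single-moebius-split`, stub `stub_truncSingularSeries`:
# auxiliary file 5 — bookkeeping for the iterated truncated singular series (peeling the last variable)

The `t`-variable Goldston–Yıldırım sum with general local data `g : ℕ → Finset (Fin t) → ℝ`,
`GY_t(R, g; y) = ∑_{1 ≤ d_i ≤ R_i} (∏_i μ(d_i) log(R_i/d_i)) ∏_{p<y} g_p(S_p(d))`, `S_p(d) = {i : p ∣ d_i}`, and its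
expected main term `∏_{p<y} β_p`, `β_p = (p/(p−1))^t ∑_{S} (−1)^{|S|} g_p(S)`, are peeled along the LAST variable:
with the conditioned data `g^{(x)}_p(S) = g_p(ι S ∪ {t}·[p ∣ x])` (`ι = Fin.castSucc`),

* `GY_{t+1}(R, g; y) = ∑_{x ≤ R_t} μ(x) log(R_t/x) GY_t(R', g^{(x)}; y)` (`tss_gy_peel`, registered);
* `∑_{T ⊆ [t+1]} (−1)^{|T|} h(T) = ∑_{S ⊆ [t]} (−1)^{|S|} h(ι S) − ∑_{S ⊆ [t]} (−1)^{|S|} h(ι S ∪ {t})`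
  (`sum_neg_one_pow_succ`), so that `β^{t+1}_p = (p/(p−1)) (B_p − A_p)` with `B_p, A_p` the `β^t`'s of the two
  conditionings;
* the local patterns of a snoc-tuple, sums over `piFinset` along `Fin.snoc`, and the generic values
  `A_p = (p/(p−1))^t/p`, `B_p = (p/(p−1))^t (1 − t/p)` for the generic data `g_p(S) = [S=∅] + [|S|=1]/p`.

References: D. A. Goldston, C. Y. Yıldırım, Integers 3 (2003) A5 = arXiv:math/0111212, §2 [GoldstonYildirim2001];
B. Green, T. Tao, Ann. of Math. 171 (2010), App. D [GreenTao2010].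
-/

noncomputable section

open Finset Real
open scoped BigOperators

namespace Summit.Parity.GeneralizedHardyLittlewood.Cruxes.RelativeDimOne.SingleMoebiusSplit

namespace TSSPeel

/-! ### Sums over `piFinset` along the last coordinate -/

/-- `∑_{d ∈ ∏_i S_i} F(d) = ∑_{x ∈ S_t} ∑_{d' ∈ ∏_{i<t} S_i} F(snoc d' x)` (tuples `Fin (t+1) → ℕ`). [folklore] -/
theorem sum_piFinset_succ {t : ℕ} {M : Type*} [AddCommMonoid M] (S : Fin (t + 1) → Finset ℕ)
    (F : (Fin (t + 1) → ℕ) → M) :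
    ∑ d ∈ Fintype.piFinset S, F d =
      ∑ x ∈ S (Fin.last t), ∑ d' ∈ Fintype.piFinset (Fin.init S), F (Fin.snoc d' x) := by
  rw [← Finset.sum_product (s := S (Fin.last t)) (t := Fintype.piFinset (Fin.init S))
    (f := fun q => F (Fin.snoc q.2 q.1))]
  refine Finset.sum_nbij' (fun d => (d (Fin.last t), Fin.init d)) (fun q => Fin.snoc q.2 q.1) ?_ ?_ ?_ ?_ ?_
  · intro d hd
    rw [Fin.mem_piFinset_iff_last_init] at hd
    exact Finset.mem_product.2 hd
  · intro q hq
    rw [Finset.mem_product] at hq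
    rw [Fin.mem_piFinset_iff_last_init, Fin.snoc_last, Fin.init_snoc]
    exact hq
  · intro d _
    exact Fin.snoc_init_self d
  · intro q _
    simp
  · intro d _
    simp [Fin.snoc_init_self]

/-! ### Local patterns of a snoc-tuple -/

/-- `S_p(snoc d' x) = ι S_p(d') ∪ {t}·[p ∣ x]`. [folklore] -/
theorem filter_dvd_snoc {t : ℕ} (d' : Fin t → ℕ) (x p : ℕ) :
    (Finset.univ.filter fun i : Fin (t + 1) => p ∣ (Fin.snoc d' x : Fin (t + 1) → ℕ) i) =
      if p ∣ x then insert (Fin.last t) ((Finset.univ.filter fun i : Fin t => p ∣ d' i).map Fin.castSuccEmb)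
      else (Finset.univ.filter fun i : Fin t => p ∣ d' i).map Fin.castSuccEmb := by
  ext i
  refine Fin.lastCases ?_ (fun j => ?_) i
  · simp only [Finset.mem_filter, Finset.mem_univ, true_and, Fin.snoc_last]
    split_ifs with h
    · simp [h]
    · simp only [h, false_iff, Finset.mem_map, Finset.mem_filter, Finset.mem_univ, true_and, not_exists,
        not_and]
      intro j _ hj
      exact absurd hj (Fin.castSucc_lt_last j).ne
  · simp only [Finset.mem_filter, Finset.mem_univ, true_and, Fin.snoc_castSucc]
    have key : (Fin.castSucc j ∈ (Finset.univ.filter fun i : Fin t => p ∣ d' i).map Fin.castSuccEmb) ↔ p ∣ d' j := by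
      simp only [Finset.mem_map, Finset.mem_filter, Finset.mem_univ, true_and, Fin.castSuccEmb_apply]
      constructor
      · rintro ⟨k, hk, hkj⟩
        rwa [← Fin.castSucc_injective _ hkj]
      · intro h; exact ⟨j, h, rfl⟩
    split_ifs with h
    · rw [Finset.mem_insert, key, or_iff_right (Fin.castSucc_lt_last j).ne]
    · exact key.symm

/-! ### Alternating sums over subsets of `Fin (t+1)` -/

/-- `∑_{T ⊆ [t+1]} (−1)^{|T|} h(T) = ∑_{S ⊆ [t]} (−1)^{|S|} h(ι S) − ∑_{S ⊆ [t]} (−1)^{|S|} h(ι S ∪ {t})`.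
[folklore] -/
theorem sum_neg_one_pow_succ {t : ℕ} (h : Finset (Fin (t + 1)) → ℝ) :
    ∑ T : Finset (Fin (t + 1)), (-1 : ℝ) ^ T.card * h T =
      ∑ S : Finset (Fin t), (-1 : ℝ) ^ S.card * h (S.map Fin.castSuccEmb) -
        ∑ S : Finset (Fin t), (-1 : ℝ) ^ S.card * h (insert (Fin.last t) (S.map Fin.castSuccEmb)) := by
  have huniv : (Finset.univ : Finset (Finset (Fin (t + 1)))) =
      (insert (Fin.last t) ((Finset.univ : Finset (Fin t)).map Fin.castSuccEmb)).powerset := by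
    rw [← Finset.powerset_univ]
    congr 1
    rw [Fin.univ_castSuccEmb]
    exact Finset.cons_eq_insert _ _ _
  have hnot : Fin.last t ∉ (Finset.univ : Finset (Fin t)).map Fin.castSuccEmb := by
    simp only [Finset.mem_map, Finset.mem_univ, true_and, not_exists, Fin.castSuccEmb_apply]
    exact fun j hj => (Fin.castSucc_lt_last j).ne hj
  rw [huniv, Finset.sum_powerset_insert hnot, sub_eq_add_neg, ← Finset.sum_neg_distrib]
  -- the powerset of `ι [t]` is the image of the powerset of `[t]` under `S ↦ ι S`
  have hinj : Set.InjOn (fun S : Finset (Fin t) => S.image Fin.castSucc)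
      ↑(Finset.univ : Finset (Finset (Fin t))) := fun S _ S' _ hSS' =>
    Finset.image_injective (Fin.castSucc_injective t) hSS'
  have hpow : ((Finset.univ : Finset (Fin t)).map Fin.castSuccEmb).powerset =
      (Finset.univ : Finset (Finset (Fin t))).image (fun S : Finset (Fin t) => S.image Fin.castSucc) := by
    rw [Finset.map_eq_image, ← Finset.powerset_univ, ← Finset.powerset_image]
    rfl
  have hmap : ∀ S : Finset (Fin t), S.image Fin.castSucc = S.map Fin.castSuccEmb := fun S => by
    rw [Finset.map_eq_image]; rfl
  congr 1
  · rw [hpow, Finset.sum_image hinj]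
    refine Finset.sum_congr rfl fun S _ => ?_
    rw [hmap, Finset.card_map]
  · rw [hpow, Finset.sum_image hinj]
    refine Finset.sum_congr rfl fun S _ => ?_
    have hS : Fin.last t ∉ S.map Fin.castSuccEmb := fun hm =>
      hnot (Finset.map_subset_map.2 (Finset.subset_univ S) hm)
    rw [hmap, Finset.card_insert_of_notMem hS, Finset.card_map, pow_succ]
    ring

/-! ### Alternating sums of bounded and of generic local data -/

/-- `|∑_{S ⊆ [t]} (−1)^{|S|} h(S)| ≤ 2^t δ` when `|h| ≤ δ`. [folklore] -/
theorem abs_sum_neg_one_pow_le {t : ℕ} (h : Finset (Fin t) → ℝ) {δ : ℝ} (hδ : ∀ S, |h S| ≤ δ) :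
    |∑ S : Finset (Fin t), (-1 : ℝ) ^ S.card * h S| ≤ 2 ^ t * δ := by
  calc |∑ S : Finset (Fin t), (-1 : ℝ) ^ S.card * h S| ≤ ∑ S : Finset (Fin t), |(-1 : ℝ) ^ S.card * h S| :=
        Finset.abs_sum_le_sum_abs _ _
    _ ≤ ∑ _S : Finset (Fin t), δ := Finset.sum_le_sum fun S _ => by
        rw [abs_mul, abs_pow, abs_neg, abs_one, one_pow, one_mul]; exact hδ S
    _ = 2 ^ t * δ := by
        rw [Finset.sum_const, nsmul_eq_mul, Finset.card_univ, Fintype.card_finset, Fintype.card_fin]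
        push_cast; ring

/-- `|∑_{S ⊆ [t]} (−1)^{|S|} h(ι S) − 1| ≤ 2^t δ` when `h(∅) = 1` and `|h(T)| ≤ δ` for `T ≠ ∅`. [folklore] -/
theorem abs_sum_neg_one_pow_sub_one_le {t : ℕ} (h : Finset (Fin (t + 1)) → ℝ) {δ : ℝ} (hδ0 : 0 ≤ δ)
    (h0 : h ∅ = 1) (hδ : ∀ T, T.Nonempty → |h T| ≤ δ) :
    |∑ S : Finset (Fin t), (-1 : ℝ) ^ S.card * h (S.map Fin.castSuccEmb) - 1| ≤ 2 ^ t * δ := by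
  rw [← Finset.sum_erase_add _ _ (Finset.mem_univ (∅ : Finset (Fin t))), Finset.card_empty, pow_zero, one_mul,
    Finset.map_empty, h0, add_sub_cancel_right]
  calc |∑ S ∈ (Finset.univ : Finset (Finset (Fin t))).erase ∅, (-1 : ℝ) ^ S.card * h (S.map Fin.castSuccEmb)|
      ≤ ∑ S ∈ (Finset.univ : Finset (Finset (Fin t))).erase ∅, |(-1 : ℝ) ^ S.card * h (S.map Fin.castSuccEmb)| :=
        Finset.abs_sum_le_sum_abs _ _
    _ ≤ ∑ _S ∈ (Finset.univ : Finset (Finset (Fin t))).erase ∅, δ := Finset.sum_le_sum fun S hS => by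
        rw [abs_mul, abs_pow, abs_neg, abs_one, one_pow, one_mul]
        refine hδ _ ?_
        rw [Finset.map_nonempty]
        exact Finset.nonempty_iff_ne_empty.2 (Finset.ne_of_mem_erase hS)
    _ ≤ ∑ _S : Finset (Fin t), δ := Finset.sum_le_sum_of_subset_of_nonneg (Finset.erase_subset _ _) fun _ _ _ => hδ0
    _ = 2 ^ t * δ := by
        rw [Finset.sum_const, nsmul_eq_mul, Finset.card_univ, Fintype.card_finset, Fintype.card_fin]
        push_cast; ring

/-- Counting subsets by size: `∑_{S ⊆ [t]} [|S| = k] c = C(t,k) c`. [folklore] -/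
theorem sum_ite_card_eq {t : ℕ} (k : ℕ) (c : ℝ) :
    ∑ S : Finset (Fin t), (if S.card = k then c else 0) = (t.choose k : ℝ) * c := by
  rw [Finset.sum_ite, Finset.sum_const_zero, add_zero, Finset.sum_const, nsmul_eq_mul]
  congr 1
  have : (Finset.univ.filter fun S : Finset (Fin t) => S.card = k) = Finset.powersetCard k Finset.univ := by
    rw [Finset.powersetCard_eq_filter, Finset.powerset_univ]
  rw [this, Finset.card_powersetCard, Finset.card_univ, Fintype.card_fin]

/-- GENERIC DATA, unconditioned: `∑_{S ⊆ [t]} (−1)^{|S|} ([|ι S| = 0] + [|ι S| = 1]/p) = 1 − t/p`. [folklore] -/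
theorem sum_generic_B (t : ℕ) (p : ℝ) :
    ∑ S : Finset (Fin t), (-1 : ℝ) ^ S.card *
        (if (S.map Fin.castSuccEmb).card = 0 then (1 : ℝ) else if (S.map Fin.castSuccEmb).card = 1 then 1 / p else 0) =
      1 - t / p := by
  have hterm : ∀ S : Finset (Fin t), (-1 : ℝ) ^ S.card *
      (if (S.map Fin.castSuccEmb).card = 0 then (1 : ℝ) else if (S.map Fin.castSuccEmb).card = 1 then 1 / p else 0) =
      (if S.card = 0 then (1 : ℝ) else 0) + (if S.card = 1 then -(1 / p) else 0) := by
    intro S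
    rw [Finset.card_map]
    by_cases h0 : S.card = 0
    · simp [h0]
    · by_cases h1 : S.card = 1
      · simp [h1]
      · simp [h0, h1]
  rw [Finset.sum_congr rfl fun S _ => hterm S, Finset.sum_add_distrib, sum_ite_card_eq, sum_ite_card_eq,
    Nat.choose_zero_right, Nat.choose_one_right]
  push_cast
  ring

/-- GENERIC DATA, conditioned on the last variable: `∑_{S ⊆ [t]} (−1)^{|S|} ([|ι S ∪ {t}| = 0] + [|ι S ∪ {t}| = 1]/p) = 1/p`.
[folklore] -/
theorem sum_generic_A (t : ℕ) (p : ℝ) :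
    ∑ S : Finset (Fin t), (-1 : ℝ) ^ S.card *
        (if (insert (Fin.last t) (S.map Fin.castSuccEmb)).card = 0 then (1 : ℝ)
          else if (insert (Fin.last t) (S.map Fin.castSuccEmb)).card = 1 then 1 / p else 0) = 1 / p := by
  have hnot : ∀ S : Finset (Fin t), Fin.last t ∉ S.map Fin.castSuccEmb := fun S => by
    simp only [Finset.mem_map, not_exists, not_and, Fin.castSuccEmb_apply]
    exact fun j _ hj => (Fin.castSucc_lt_last j).ne hj
  have hterm : ∀ S : Finset (Fin t), (-1 : ℝ) ^ S.card *
      (if (insert (Fin.last t) (S.map Fin.castSuccEmb)).card = 0 then (1 : ℝ)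
        else if (insert (Fin.last t) (S.map Fin.castSuccEmb)).card = 1 then 1 / p else 0) =
      (if S.card = 0 then 1 / p else 0) := by
    intro S
    rw [Finset.card_insert_of_notMem (hnot S), Finset.card_map]
    by_cases h0 : S.card = 0
    · simp [h0]
    · simp [h0]
  rw [Finset.sum_congr rfl fun S _ => hterm S, sum_ite_card_eq, Nat.choose_zero_right]
  push_cast
  ring

/-! ### Elementary bounds for `(p/(p−1))^t` -/

/-- `1 ≤ (p/(p−1))^t` for `p ≥ 2`. [folklore] -/
theorem one_le_div_pred_pow {p : ℕ} (hp : 2 ≤ p) (t : ℕ) : (1 : ℝ) ≤ ((p : ℝ) / ((p : ℝ) - 1)) ^ t := by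
  have hp2 : (2 : ℝ) ≤ p := by exact_mod_cast hp
  refine one_le_pow₀ ?_
  rw [le_div_iff₀ (by linarith)]; linarith

/-- `0 ≤ (p/(p−1))^t (1 − t/p) ≤ 1` for `p > t`, `p ≥ 2` (Bernoulli: `1 − t/p ≤ (1 − 1/p)^t`). [folklore] -/
theorem div_pred_pow_mul_bounds {p : ℕ} (hp : 2 ≤ p) {t : ℕ} (hpt : t < p) :
    0 ≤ ((p : ℝ) / ((p : ℝ) - 1)) ^ t * (1 - t / p) ∧ ((p : ℝ) / ((p : ℝ) - 1)) ^ t * (1 - t / p) ≤ 1 := by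
  have hp2 : (2 : ℝ) ≤ p := by exact_mod_cast hp
  have hp0 : (0 : ℝ) < p := by linarith
  have hpt' : (t : ℝ) < p := by exact_mod_cast hpt
  have h1 : 0 ≤ 1 - (t : ℝ) / p := by rw [sub_nonneg, div_le_one hp0]; exact hpt'.le
  refine ⟨mul_nonneg (le_trans zero_le_one (one_le_div_pred_pow hp t)) h1, ?_⟩
  -- Bernoulli: `1 - t/p ≤ (1 - 1/p)^t = ((p-1)/p)^t`
  have hB : 1 - (t : ℝ) / p ≤ (1 - 1 / (p : ℝ)) ^ t := by
    have := one_add_mul_le_pow (a := -(1 / (p : ℝ))) (by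
      have : (1 : ℝ) / p ≤ 1 := by rw [div_le_one hp0]; linarith
      linarith) t
    rw [mul_neg, ← sub_eq_add_neg, mul_one_div] at this
    simpa [sub_eq_add_neg] using this
  have heq : (1 - 1 / (p : ℝ)) = ((p : ℝ) / ((p : ℝ) - 1))⁻¹ := by
    rw [inv_div]; field_simp
  rw [heq, inv_pow] at hB
  have hpos : 0 < ((p : ℝ) / ((p : ℝ) - 1)) ^ t := lt_of_lt_of_le zero_lt_one (one_le_div_pred_pow hp t)
  calc ((p : ℝ) / ((p : ℝ) - 1)) ^ t * (1 - t / p) ≤ ((p : ℝ) / ((p : ℝ) - 1)) ^ t * (((p : ℝ) / ((p : ℝ) - 1)) ^ t)⁻¹ :=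
        mul_le_mul_of_nonneg_left hB hpos.le
    _ = 1 := mul_inv_cancel₀ hpos.ne'

end TSSPeel

/-! ### The registered sub-goal of this file: peeling the last variable -/

open TSSPeel in
/-- **Peeling the last variable of the `t`-variable Goldston–Yıldırım sum** (sub-goal `tss_gy_peel` of
`stub_truncSingularSeries`): with local data `g : ℕ → Finset (Fin (t+1)) → ℝ` and levels `R`,
`∑_{d ∈ ∏_{i ≤ t} [1, R_i]} (∏_i μ(d_i) log(R_i/d_i)) ∏_{p<y} g_p({i : p ∣ d_i})`
`= ∑_{x ≤ R_t} μ(x) log(R_t/x) ∑_{d' ∈ ∏_{i<t}[1,R_i]} (∏_{i<t} μ(d'_i) log(R_i/d'_i)) ∏_{p<y} g_p(ι{i : p ∣ d'_i} ∪ {t}·[p ∣ x])`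
(`ι = Fin.castSucc`; the inner sum is the `t`-variable sum of the data conditioned on `x`). [folklore] -/
theorem tss_gy_peel : ∀ (t : ℕ) (R : Fin (t + 1) → ℝ) (g : ℕ → Finset (Fin (t + 1)) → ℝ) (y : ℕ),
    ∑ d ∈ Fintype.piFinset (fun i : Fin (t + 1) => Finset.Icc 1 ⌊R i⌋₊),
        (∏ i, ((ArithmeticFunction.moebius (d i) : ℤ) : ℝ) * Real.log (R i / d i)) *
          ∏ p ∈ Nat.primesBelow y, g p (Finset.univ.filter fun i => p ∣ d i) =
      ∑ x ∈ Finset.Icc 1 ⌊R (Fin.last t)⌋₊, ((ArithmeticFunction.moebius x : ℤ) : ℝ) *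
        Real.log (R (Fin.last t) / x) *
        ∑ d ∈ Fintype.piFinset (fun i : Fin t => Finset.Icc 1 ⌊R (Fin.castSucc i)⌋₊),
          (∏ i, ((ArithmeticFunction.moebius (d i) : ℤ) : ℝ) * Real.log (R (Fin.castSucc i) / d i)) *
            ∏ p ∈ Nat.primesBelow y, g p (if p ∣ x then
              insert (Fin.last t) ((Finset.univ.filter fun i => p ∣ d i).map Fin.castSuccEmb)
              else (Finset.univ.filter fun i => p ∣ d i).map Fin.castSuccEmb) := by
  intro t R g y
  rw [sum_piFinset_succ]
  refine Finset.sum_congr rfl fun x _ => ?_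
  rw [Finset.mul_sum]
  refine Finset.sum_congr rfl fun d' _ => ?_
  rw [Fin.prod_univ_castSucc]
  simp only [Fin.snoc_castSucc, Fin.snoc_last]
  simp_rw [filter_dvd_snoc d' x]
  ring

end Summit.Parity.GeneralizedHardyLittlewood.Cruxes.RelativeDimOne.SingleMoebiusSplit

end
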